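import Summits.Ventures.Crystal3D.Theorems.StickyWulffConstantTextureBuildBarlowShells
import Summits.Ventures.Crystal3D.Theorems.StickyWulffConstantTextureBuildMeshV2
import Summits.Ventures.Crystal3D.Theorems.StickyWulffConstantTextureLiminfTentBarlowFrames
import HarnessLib

/-!
# TB-D: MASS BRICKS — Voronoi cells of a locally perfect Barlow site (M1)–(M3)
# (lane T, crux `TextureLiminfV5`, stmt-Ventures-23912; design memo TB-D-0 §3 (mass without Kepler), §5; helper seat wulff-tb-w1; part 2 of the MASS bricks)

HONEST FRAMING. Venture `Summits/Ventures/Crystal3D` (cell `crystal3d-full`), route `route-Ventures-StickyWulffConstant`, helper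
`--supports` the law-v5 crux `TextureLiminfV5` (stmt-Ventures-23912).  Elementary metric geometry of the moved Barlow stackings
`stacking L s σ` (census-free, standard axioms); nothing about any texture, cover or mesh beyond the two one-line corollaries for
`CellCover.LocPerfect` / `CellCover.X'`; F-C1 not moved.  Shapes agreed with wulff-p2 g19 on the cell bus (08:49:39Z): `1`-separation as
`X.Pairwise (1 ≤ dist · ·)` over `X : Set E3` (so `X := ↑cv.X'`), stackings as `stacking L s σ` + `IsHaggSeq σ` exactly as in `CellCover.LocPerfect`.

Write `S = stacking L s σ` (Hägg word `σ`), `a ∈ S`, and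
* the OPEN VORONOI CELL of `a` in a point set `X`:        `{z | ∀ x ∈ X, x ≠ a → dist z a < dist z x}`;
* the TWELVE-NEIGHBOUR (lattice) CELL of `a` in `S`:       `{z | ∀ v ∈ S, dist a v = 1 → dist z a < dist z v}`.
(Both spelled out; no definition is introduced.)

* (M1) `disjoint_voronoiCell` — open Voronoi cells of distinct points of `X` are disjoint (trivial).
* (M2) `mem_stacking_of_near_complete` — if `X` is `1`-separated and contains every site of `S` within `2√2` of `a`, then every point of `X`
  within `2` of `a` IS a site of `S` (a foreign ball would be `< 1` from an occupied site, by the covering radius `1/√2` of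
  `…TextureBuildBarlowShells`); `CellCover.LocPerfect.exists_stacking` is the same read off `LocPerfect` (`X = cv.X'`, separation `CellCover.X'_sep`).
* (M3) `dist_lt_of_mem_cell₁₂` — **the twelve-neighbour cell lies in the OPEN ball `ball a (√2/2)`** (the circumradius `1/√2` of BOTH close-packed
  cells, attained only at the octahedral-hole vertices, which are not in the open cell; proof by the covering radius, the distance trichotomy and
  the octahedron lemma of `…TextureBuildBarlowShells` — no coordinates of the cell are used, so fcc-like and hcp-like sites are treated at once);
  `cell₁₂_subset_ball`, `cell₁₂_subset_closedBall`, `isBounded_cell₁₂`, `isOpen_cell₁₂`, `mem_cell₁₂_self`, `mem_cell₁₂_of_smul` (star-shaped);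
  and `cell₁₂_subset_voronoiCell` — under (M2)'s hypotheses the twelve-neighbour cell is inside the Voronoi cell of `a` in `X`, whence
  `disjoint_cell₁₂` (these cells are pairwise disjoint) and they lie in `closedBall a √2 ⊆` the texture (TB-D-0 §3 (M5)); `cell₁₂_subset_voronoiCell_X'`.
The cell VOLUME `1/√2` ((M4): a.e. fundamental domain) is a separate file.
-/

noncomputable section

open scoped BigOperators InnerProductSpace

namespace Summit.Ventures.Crystal3D.Cruxes.TextureLiminf.TexShadow

open Summit.Ventures.Crystal3D Metric
open Summit.Ventures.Crystal3D.TentCertificate (hB hB_sq hB_pos finite_touching)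
open Literature.MathematicalPhysics.StatisticalMechanics (IsHaggSeq)

/-! ### (M1) Open Voronoi cells are disjoint -/

/-- **(M1)** The open Voronoi cells `{z | ∀ x ∈ X, x ≠ a → dist z a < dist z x}` of two distinct points `a ≠ b` of `X` are disjoint. -/
theorem disjoint_voronoiCell {X : Set E3} {a b : E3} (ha : a ∈ X) (hb : b ∈ X) (hab : a ≠ b) :
    Disjoint {z : E3 | ∀ x ∈ X, x ≠ a → dist z a < dist z x} {z : E3 | ∀ x ∈ X, x ≠ b → dist z b < dist z x} := by
  refine Set.disjoint_left.2 fun z hza hzb => ?_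
  have h1 := hza b hb (Ne.symm hab)
  have h2 := hzb a ha hab
  exact lt_asymm h1 h2

/-! ### (M2) A complete neighbourhood contains no foreign balls -/

/-- **(M2), quantitative form.**  Let `X` be `1`-separated and contain every site of `S = stacking L s σ` within `2√2` of the site `a`.  Then every point
`x ∈ X` with `dist a x + √2/2 ≤ 2√2` is a site of `S`: by the covering radius there is a site `b` within `√2/2 < 1` of `x`, it is within `2√2` of `a`,
hence occupied, hence equal to `x`. -/
theorem mem_stacking_of_near_complete' {σ : ℤ → ℤ} {L : E3 ≃ₗᵢ[ℝ] E3} {s : E3} {X : Set E3}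
    (hX : X.Pairwise fun p q => 1 ≤ dist p q) {a : E3} (hcomp : ∀ b ∈ stacking L s σ, dist a b ≤ 2 * Real.sqrt 2 → b ∈ X)
    {x : E3} (hx : x ∈ X) (hd : dist a x + Real.sqrt 2 / 2 ≤ 2 * Real.sqrt 2) : x ∈ stacking L s σ := by
  obtain ⟨b, hb, hdb⟩ := exists_mem_stacking_dist_sq_le_half L s σ x
  have h2 : Real.sqrt 2 ^ 2 = 2 := Real.sq_sqrt (by norm_num)
  have hs2 : 0 < Real.sqrt 2 := by positivity
  have hxb : dist x b ≤ Real.sqrt 2 / 2 := by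
    have : (Real.sqrt 2 / 2) ^ 2 = 1 / 2 := by rw [div_pow, h2]; norm_num
    exact (pow_le_pow_iff_left₀ dist_nonneg (by positivity) two_ne_zero).1 (by rw [this]; exact hdb)
  have hbX : b ∈ X := hcomp b hb (by linarith [dist_triangle a x b])
  by_cases hxb' : x = b
  · rw [hxb']; exact hb
  · have h1 := hX hx hbX hxb'
    nlinarith

/-- **(M2)**  `X` `1`-separated, all sites of `stacking L s σ` within `2√2` of the site `a` in `X` ⇒ every `x ∈ X` with `dist a x ≤ 2` is a site. -/
theorem mem_stacking_of_near_complete {σ : ℤ → ℤ} {L : E3 ≃ₗᵢ[ℝ] E3} {s : E3} {X : Set E3}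
    (hX : X.Pairwise fun p q => 1 ≤ dist p q) {a : E3} (hcomp : ∀ b ∈ stacking L s σ, dist a b ≤ 2 * Real.sqrt 2 → b ∈ X)
    {x : E3} (hx : x ∈ X) (hd : dist a x ≤ 2) : x ∈ stacking L s σ := by
  refine mem_stacking_of_near_complete' hX hcomp hx ?_
  have h2 : Real.sqrt 2 ^ 2 = 2 := Real.sq_sqrt (by norm_num)
  have hs2 : 0 < Real.sqrt 2 := by positivity
  -- `2 + √2/2 ≤ 2√2` since `4 ≤ 3√2`
  nlinarith

/-- **(M2) for `LocPerfect`.**  A locally perfect ball `a` of a cell cover carries a Barlow stacking through it whose sites within `2√2` are balls and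
which contains every ball within `2` of `a`. -/
theorem CellCover.LocPerfect.exists_stacking {C R₀ : ℝ} {N : ℕ} {x : Fin N → E3} {cv : CellCover C R₀ N x} {a : E3} (h : cv.LocPerfect a) :
    ∃ (L : E3 ≃ₗᵢ[ℝ] E3) (s : E3) (σ : ℤ → ℤ), IsHaggSeq σ ∧ a ∈ stacking L s σ ∧
      (∀ b ∈ stacking L s σ, dist a b ≤ 2 * Real.sqrt 2 → b ∈ cv.X') ∧ ∀ y ∈ cv.X', dist a y ≤ 2 → y ∈ stacking L s σ := by
  obtain ⟨L, s, σ, hσ, ha, hcomp⟩ := h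
  refine ⟨L, s, σ, hσ, ha, hcomp, fun y hy hd => ?_⟩
  exact mem_stacking_of_near_complete (X := (↑cv.X' : Set E3)) (fun p hp q hq hpq => cv.X'_sep p hp q hq hpq) hcomp hy hd

/-! ### (M3) The twelve-neighbour cell lies in the open ball of radius `√2/2` -/

/-- Half-space form of a Voronoi comparison against a point at distance `1`: `dist z a < dist z v ↔ ⟪z − a, v − a⟫ < 1/2`. -/
theorem dist_lt_dist_iff_inner_lt_half {a v z : E3} (hav : dist a v = 1) : dist z a < dist z v ↔ ⟪z - a, v - a⟫_ℝ < 1 / 2 := by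
  have hva : ‖v - a‖ = 1 := by rw [← dist_eq_norm, dist_comm, hav]
  have key : dist z v ^ 2 = dist z a ^ 2 - 2 * ⟪z - a, v - a⟫_ℝ + 1 := by
    rw [dist_eq_norm, dist_eq_norm, show z - v = (z - a) - (v - a) by abel, norm_sub_sq_real, hva, one_pow]
  rw [← sq_lt_sq₀ dist_nonneg dist_nonneg, key]
  constructor <;> intro h <;> linarith

/-- The same, non-strict. -/
theorem dist_le_dist_iff_inner_le_half {a v z : E3} (hav : dist a v = 1) : dist z a ≤ dist z v ↔ ⟪z - a, v - a⟫_ℝ ≤ 1 / 2 := by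
  have hva : ‖v - a‖ = 1 := by rw [← dist_eq_norm, dist_comm, hav]
  have key : dist z v ^ 2 = dist z a ^ 2 - 2 * ⟪z - a, v - a⟫_ℝ + 1 := by
    rw [dist_eq_norm, dist_eq_norm, show z - v = (z - a) - (v - a) by abel, norm_sub_sq_real, hva, one_pow]
  rw [← sq_le_sq₀ dist_nonneg dist_nonneg, key]
  constructor <;> intro h <;> linarith

/-- The site itself lies in its twelve-neighbour cell. -/
theorem mem_cell₁₂_self (S : Set E3) (a : E3) : a ∈ {z : E3 | ∀ v ∈ S, dist a v = 1 → dist z a < dist z v} := by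
  intro v _ hv
  rw [dist_self, hv]; exact one_pos

/-- The twelve-neighbour cell of a site of a moved Hägg stacking is open (finitely many neighbours). -/
theorem isOpen_cell₁₂ {σ : ℤ → ℤ} (hσ : IsHaggSeq σ) {L : E3 ≃ₗᵢ[ℝ] E3} {s : E3} {a : E3} (ha : a ∈ stacking L s σ) :
    IsOpen {z : E3 | ∀ v ∈ stacking L s σ, dist a v = 1 → dist z a < dist z v} := by
  have hfin := finite_touching hσ ha
  have heq : {z : E3 | ∀ v ∈ stacking L s σ, dist a v = 1 → dist z a < dist z v} =
      ⋂ v ∈ {y | y ∈ stacking L s σ ∧ dist a y = 1}, {z : E3 | dist z a < dist z v} := by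
    ext z
    simp only [Set.mem_setOf_eq, Set.mem_iInter, and_imp]
  rw [heq]
  exact hfin.isOpen_biInter fun v _ => isOpen_lt (continuous_id.dist continuous_const) (continuous_id.dist continuous_const)

/-- Scaling towards the site keeps a point in the cell: if `z` is in the cell and `0 < t ≤ 1` then so is `a + t • (z − a)`. -/
theorem mem_cell₁₂_of_smul {S : Set E3} {a z : E3} (hz : z ∈ {z : E3 | ∀ v ∈ S, dist a v = 1 → dist z a < dist z v}) {t : ℝ}
    (ht0 : 0 < t) (ht1 : t ≤ 1) : a + t • (z - a) ∈ {z : E3 | ∀ v ∈ S, dist a v = 1 → dist z a < dist z v} := by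
  intro v hv hav
  have h := (dist_lt_dist_iff_inner_lt_half hav).1 (hz v hv hav)
  rw [dist_lt_dist_iff_inner_lt_half hav, add_sub_cancel_left, real_inner_smul_left]
  by_cases hneg : ⟪z - a, v - a⟫_ℝ ≤ 0
  · nlinarith
  · push Not at hneg
    nlinarith

/-- Apollonius for a pair of antipodal pairs: if `v + v' = a + b` and `‖v − v'‖ = ‖a − b‖` then `dist q v² + dist q v'² = dist q a² + dist q b²`. -/
theorem dist_sq_add_dist_sq_eq_of_antipodal {a b v v' q : E3} (hsum : v + v' = a + b) (hdiag : dist v v' = dist a b) :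
    dist q v ^ 2 + dist q v' ^ 2 = dist q a ^ 2 + dist q b ^ 2 := by
  have hv' : v' = a + b - v := by rw [← hsum]; abel
  subst hv'
  simp only [dist_eq_norm] at hdiag ⊢
  have hd2 : ‖v - (a + b - v)‖ ^ 2 = ‖a - b‖ ^ 2 := by rw [hdiag]
  rw [← real_inner_self_eq_norm_sq, ← real_inner_self_eq_norm_sq] at hd2
  rw [← real_inner_self_eq_norm_sq, ← real_inner_self_eq_norm_sq, ← real_inner_self_eq_norm_sq, ← real_inner_self_eq_norm_sq]
  simp only [inner_sub_left, inner_sub_right, inner_add_left, inner_add_right, real_inner_comm a b, real_inner_comm a v,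
    real_inner_comm b v, real_inner_comm q a, real_inner_comm q b, real_inner_comm q v] at hd2 ⊢
  linarith

/-- The equatorial square has the same diagonal as the octahedron: for common unit neighbours `v, v'` of `a, b` (`dist a b = √2`) with
`v + v' = a + b`, `dist v v' = √2`. -/
theorem dist_eq_of_common_neighbours {a b v v' : E3} (hab : dist a b = Real.sqrt 2) (h1 : dist a v = 1) (h2 : dist b v = 1)
    (hsum : v + v' = a + b) : dist v v' = dist a b := by
  have hv' : v' = a + b - v := by rw [← hsum]; abel
  subst hv'
  have h2sq : Real.sqrt 2 ^ 2 = 2 := Real.sq_sqrt (by norm_num)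
  rw [dist_eq_norm] at hab h1 h2 ⊢
  rw [dist_eq_norm]
  have e : v - (a + b - v) = -(a - v) - (b - v) := by abel
  have hsq : ‖v - (a + b - v)‖ ^ 2 = ‖a - b‖ ^ 2 := by
    rw [e, norm_sub_sq_real, norm_neg, inner_neg_left, h1, h2, show a - b = (a - v) - (b - v) by abel, norm_sub_sq_real, h1, h2]
    -- `⟪a - v, b - v⟫ = 0` from `‖a - b‖² = 2`
    have hab2 : ‖(a - v) - (b - v)‖ ^ 2 = 2 := by rw [show (a - v) - (b - v) = a - b by abel, hab, h2sq]
    rw [norm_sub_sq_real, h1, h2] at hab2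
    linarith
  have := (sq_eq_sq₀ (norm_nonneg _) (norm_nonneg _)).1 hsq
  rw [this]

/-- **(M3) The twelve-neighbour cell lies in the open ball of radius `√2/2` about its site** (both close-packed local configurations at once).
Proof: scale a far cell point to distance just above `√2/2` (the cell is open and star-shaped about `a`); the covering radius gives a site
`b ≠ a` at least as close; `b` is a neighbour (contradiction), or at distance `√2` — then one of the two antipodal common neighbours of `a, b` is
at least as close as `a` (Apollonius), contradiction — or at distance `≥ √(8/3) > √2 + 1/10`, impossible. -/
theorem dist_lt_of_mem_cell₁₂ {σ : ℤ → ℤ} (hσ : IsHaggSeq σ) {L : E3 ≃ₗᵢ[ℝ] E3} {s : E3} {a : E3} (ha : a ∈ stacking L s σ) {z : E3}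
    (hz : z ∈ {z : E3 | ∀ v ∈ stacking L s σ, dist a v = 1 → dist z a < dist z v}) : dist z a < Real.sqrt 2 / 2 := by
  by_contra hfar
  push Not at hfar
  have h2sq : Real.sqrt 2 ^ 2 = 2 := Real.sq_sqrt (by norm_num)
  have hs2 : 0 < Real.sqrt 2 := by positivity
  have hs2' : Real.sqrt 2 < 3 / 2 := by nlinarith
  have hza : 0 < dist z a := lt_of_lt_of_le (by positivity) hfar
  -- Step 1: a cell point `z₁` with `dist z₁ a > √2/2` (openness)
  obtain ⟨ε, hε, hball⟩ := Metric.isOpen_iff.1 (isOpen_cell₁₂ hσ ha) z hz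
  set η : ℝ := ε / (2 * dist z a) with hη
  have hη0 : 0 < η := by positivity
  set z₁ : E3 := z + η • (z - a) with hz₁
  have hz₁mem : z₁ ∈ {z : E3 | ∀ v ∈ stacking L s σ, dist a v = 1 → dist z a < dist z v} := by
    apply hball
    rw [Metric.mem_ball, hz₁, dist_eq_norm, add_sub_cancel_left, norm_smul, Real.norm_of_nonneg hη0.le, ← dist_eq_norm, hη,
      div_mul_eq_mul_div, div_lt_iff₀ (by positivity)]
    nlinarith [mul_pos hε hza]
  have hz₁a : dist z₁ a = (1 + η) * dist z a := by
    rw [hz₁, dist_eq_norm, dist_eq_norm, show z + η • (z - a) - a = (1 + η) • (z - a) by rw [add_smul, one_smul]; abel, norm_smul,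
      Real.norm_of_nonneg (by linarith)]
  have hz₁far : Real.sqrt 2 / 2 < dist z₁ a := by
    have : 0 < η * dist z a := mul_pos hη0 hza
    rw [hz₁a]; linarith
  -- Step 2: scale back to a cell point `q` with `√2/2 < dist q a ≤ √2/2 + 1/10`
  have hz₁pos : 0 < dist z₁ a := lt_trans (by positivity) hz₁far
  set t : ℝ := min 1 ((Real.sqrt 2 / 2 + 1 / 10) / dist z₁ a) with ht
  have ht0 : 0 < t := lt_min one_pos (by positivity)
  have ht1 : t ≤ 1 := min_le_left _ _
  set q : E3 := a + t • (z₁ - a) with hq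
  have hqmem := mem_cell₁₂_of_smul hz₁mem ht0 ht1
  have hqa : dist q a = t * dist z₁ a := by
    rw [hq, dist_eq_norm, dist_eq_norm, add_sub_cancel_left, norm_smul, Real.norm_of_nonneg ht0.le]
  have hqa_gt : Real.sqrt 2 / 2 < dist q a := by
    rw [hqa, ht]
    rcases le_total 1 ((Real.sqrt 2 / 2 + 1 / 10) / dist z₁ a) with h | h
    · rw [min_eq_left h, one_mul]; exact hz₁far
    · rw [min_eq_right h, div_mul_cancel₀ _ hz₁pos.ne']; linarith
  have hqa_le : dist q a ≤ Real.sqrt 2 / 2 + 1 / 10 := by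
    rw [hqa]
    calc t * dist z₁ a ≤ (Real.sqrt 2 / 2 + 1 / 10) / dist z₁ a * dist z₁ a :=
          mul_le_mul_of_nonneg_right (min_le_right _ _) dist_nonneg
      _ = Real.sqrt 2 / 2 + 1 / 10 := div_mul_cancel₀ _ hz₁pos.ne'
  -- Step 3: a site `b ≠ a` at least as close to `q` as `√2/2`
  obtain ⟨b, hb, hqb2⟩ := exists_mem_stacking_dist_sq_le_half L s σ q
  have hqb : dist q b ≤ Real.sqrt 2 / 2 := by
    have : (Real.sqrt 2 / 2) ^ 2 = 1 / 2 := by rw [div_pow, h2sq]; norm_num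
    exact (pow_le_pow_iff_left₀ dist_nonneg (by positivity) two_ne_zero).1 (by rw [this]; exact hqb2)
  have hba : b ≠ a := by
    rintro rfl; linarith
  have hab : dist a b ≤ Real.sqrt 2 + 1 / 10 := by linarith [dist_triangle a q b, dist_comm a q]
  rcases dist_trichotomy_of_mem_stacking hσ ha hb (Ne.symm hba) with h1 | h2 | h3
  · -- `b` is one of the twelve neighbours
    have := hqmem b hb h1
    linarith
  · -- `b` is across an octahedral hole: a common neighbour is at least as close as `a`
    obtain ⟨v, v', hv, hv', hav, hbv, hav', hbv', hsum⟩ := exists_common_neighbours_of_dist_eq_sqrt_two hσ ha hb h2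
    have hdiag := dist_eq_of_common_neighbours h2 hav hbv hsum
    have hap := dist_sq_add_dist_sq_eq_of_antipodal (q := q) hsum hdiag
    have hv1 := hqmem v hv hav
    have hv2 := hqmem v' hv' hav'
    have hqb' : dist q b ^ 2 ≤ dist q a ^ 2 := by
      have : dist q b ≤ dist q a := by linarith
      exact pow_le_pow_left₀ dist_nonneg this 2
    nlinarith [dist_nonneg (x := q) (y := v), dist_nonneg (x := q) (y := v'), dist_nonneg (x := q) (y := a)]
  · -- `b` is at distance `≥ √(8/3) > √2 + 1/10`
    nlinarith [dist_nonneg (x := a) (y := b)]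

/-- **(M3), set form**: the twelve-neighbour cell of a site is inside `ball a (√2/2)`. -/
theorem cell₁₂_subset_ball {σ : ℤ → ℤ} (hσ : IsHaggSeq σ) {L : E3 ≃ₗᵢ[ℝ] E3} {s : E3} {a : E3} (ha : a ∈ stacking L s σ) :
    {z : E3 | ∀ v ∈ stacking L s σ, dist a v = 1 → dist z a < dist z v} ⊆ Metric.ball a (Real.sqrt 2 / 2) :=
  fun _ hz => Metric.mem_ball.2 (dist_lt_of_mem_cell₁₂ hσ ha hz)

/-- The twelve-neighbour cell is inside `closedBall a √2` (the radius at which the mesh certifies texture around a counted ball). -/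
theorem cell₁₂_subset_closedBall {σ : ℤ → ℤ} (hσ : IsHaggSeq σ) {L : E3 ≃ₗᵢ[ℝ] E3} {s : E3} {a : E3} (ha : a ∈ stacking L s σ) :
    {z : E3 | ∀ v ∈ stacking L s σ, dist a v = 1 → dist z a < dist z v} ⊆ Metric.closedBall a (Real.sqrt 2) := by
  intro z hz
  have h := dist_lt_of_mem_cell₁₂ hσ ha hz
  rw [Metric.mem_closedBall]
  have hs2 : 0 ≤ Real.sqrt 2 := Real.sqrt_nonneg 2
  linarith

/-- The twelve-neighbour cell is bounded. -/
theorem isBounded_cell₁₂ {σ : ℤ → ℤ} (hσ : IsHaggSeq σ) {L : E3 ≃ₗᵢ[ℝ] E3} {s : E3} {a : E3} (ha : a ∈ stacking L s σ) :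
    Bornology.IsBounded {z : E3 | ∀ v ∈ stacking L s σ, dist a v = 1 → dist z a < dist z v} :=
  Metric.isBounded_ball.subset (cell₁₂_subset_ball hσ ha)

/-! ### (M3) The twelve-neighbour cell is inside the Voronoi cell of a locally perfect ball -/

/-- **(M3 ⊆ V)**  If `X` is `1`-separated and contains every site of `S = stacking L s σ` within `2√2` of the site `a`, the twelve-neighbour cell
of `a` in `S` is contained in the open Voronoi cell of `a` in `X`: a competitor `x ∈ X` within `2` of `a` is a site (M2), hence a neighbour or at
distance `≥ √2 > 2·dist z a`; a competitor beyond `2` is farther still. -/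
theorem cell₁₂_subset_voronoiCell {σ : ℤ → ℤ} (hσ : IsHaggSeq σ) {L : E3 ≃ₗᵢ[ℝ] E3} {s : E3} {X : Set E3}
    (hX : X.Pairwise fun p q => 1 ≤ dist p q) {a : E3} (ha : a ∈ stacking L s σ)
    (hcomp : ∀ b ∈ stacking L s σ, dist a b ≤ 2 * Real.sqrt 2 → b ∈ X) :
    {z : E3 | ∀ v ∈ stacking L s σ, dist a v = 1 → dist z a < dist z v} ⊆ {z : E3 | ∀ x ∈ X, x ≠ a → dist z a < dist z x} := by
  intro z hz x hx hxa
  have hza := dist_lt_of_mem_cell₁₂ hσ ha hz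
  have hs2 : 0 < Real.sqrt 2 := by positivity
  have hs2' : Real.sqrt 2 < 2 := by
    have h2sq : Real.sqrt 2 ^ 2 = 2 := Real.sq_sqrt (by norm_num)
    nlinarith
  have htri : dist a x ≤ dist z a + dist z x := by rw [dist_comm z a]; exact dist_triangle a z x
  by_cases h2 : dist a x ≤ 2
  · have hxS := mem_stacking_of_near_complete hX hcomp hx h2
    by_cases h1 : dist a x = 1
    · exact hz x hxS h1
    · have hge := sqrt_two_le_dist_of_mem_stacking hσ ha hxS (Ne.symm hxa) h1
      linarith
  · push Not at h2
    linarith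

/-- **(M3 ⊆ V) for `LocPerfect`**: the twelve-neighbour cell of a locally perfect ball, in the stacking provided by `LocPerfect.exists_stacking`, is
inside its Voronoi cell in the filled configuration `cv.X'`. -/
theorem cell₁₂_subset_voronoiCell_X' {C R₀ : ℝ} {N : ℕ} {x : Fin N → E3} (cv : CellCover C R₀ N x) {σ : ℤ → ℤ} (hσ : IsHaggSeq σ)
    {L : E3 ≃ₗᵢ[ℝ] E3} {s : E3} {a : E3} (ha : a ∈ stacking L s σ) (hcomp : ∀ b ∈ stacking L s σ, dist a b ≤ 2 * Real.sqrt 2 → b ∈ cv.X') :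
    {z : E3 | ∀ v ∈ stacking L s σ, dist a v = 1 → dist z a < dist z v} ⊆ {z : E3 | ∀ y ∈ cv.X', y ≠ a → dist z a < dist z y} :=
  cell₁₂_subset_voronoiCell (X := (↑cv.X' : Set E3)) hσ (fun p hp q hq hpq => cv.X'_sep p hp q hq hpq) ha hcomp

/-- **Pairwise disjointness of the twelve-neighbour cells of locally perfect balls** (M1 + M3): for two distinct balls `a ≠ a'` of a `1`-separated
`X`, each carrying a stacking complete within `2√2`, the two cells are disjoint. -/
theorem disjoint_cell₁₂ {σ σ' : ℤ → ℤ} (hσ : IsHaggSeq σ) (hσ' : IsHaggSeq σ') {L L' : E3 ≃ₗᵢ[ℝ] E3} {s s' : E3} {X : Set E3}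
    (hX : X.Pairwise fun p q => 1 ≤ dist p q) {a a' : E3} (haa' : a ≠ a') (ha : a ∈ stacking L s σ) (ha' : a' ∈ stacking L' s' σ')
    (hcomp : ∀ b ∈ stacking L s σ, dist a b ≤ 2 * Real.sqrt 2 → b ∈ X) (hcomp' : ∀ b ∈ stacking L' s' σ', dist a' b ≤ 2 * Real.sqrt 2 → b ∈ X) :
    Disjoint {z : E3 | ∀ v ∈ stacking L s σ, dist a v = 1 → dist z a < dist z v}
      {z : E3 | ∀ v ∈ stacking L' s' σ', dist a' v = 1 → dist z a' < dist z v} := by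
  have haX : a ∈ X := hcomp a ha (by rw [dist_self]; positivity)
  have ha'X : a' ∈ X := hcomp' a' ha' (by rw [dist_self]; positivity)
  exact Set.disjoint_of_subset (cell₁₂_subset_voronoiCell hσ hX ha hcomp) (cell₁₂_subset_voronoiCell hσ' hX ha' hcomp')
    (disjoint_voronoiCell haX ha'X haa')

end Summit.Ventures.Crystal3D.Cruxes.TextureLiminf.TexShadow

end
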